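import Summits.AnomalousDissipation.AnomalousDissipation.Theorems.CubicParityLoud.Negative.Anatomy
import Literature.Analysis.FluidPDE.StatisticalSolutionDirac

/-!
# Negative knowledge for the crux `MomentParity.CubicParityLoud` (stmt-AnomalousDissipation-11465), V:
# the mean flow does the work; the laminar ceiling

Certified copy of §8–§9 of the cdisprove work file `Cruxes/CubicParityLoud/Disproof.lean`
(refuter-cdisprove-stmt-AnomalousDissipation-11465-0, cycle 1). Supports stmt-AnomalousDissipation-11465;
nothing here closes an item.

* §8 The level-`N` MEAN FLOW `ū_N = Σ_i (∫(u,e_i)dμ) e_i` of a law on `H` (Galerkin frame `e_i` of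
  `Torus.galerkinTest N`) is an admissible test of the crux (`isBandTest_meanFlow`) and satisfies
  `(ū_N, g) = ∫ (u, g) dμ` for every `L²` field `g` band-limited to the ball (`integral_inner_meanFlow`).
  With the energy row: **`ε ≤ ‖f‖₂ ‖ū_N‖₂` for every witness** (`IsWitness.le_meanFlow`) — loudness is the
  work of a MACROSCOPIC MEAN FLOW; no zero-mean-flow statistics can witness the crux at any level.
* §9 LAMINAR CEILING `ε ≤ ‖f‖₂²/(4π²ν)` (`IsWitness.laminar`: mean-flow work identity + `‖ū_N‖₂ ≤ ∫‖u‖dμ` +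
  Poincaré in the mean `4π²·ensembleEnergy ≤ ensembleDissipation/ν`), so witnesses exist only for
  `ν ≤ ‖f‖₂²/(4π²ε)`: the viscosity threshold is load-bearing and the strengthening without `ν < ν₀` is false
  (`not_cubicParityLoudAllViscosities`).
-/

noncomputable section

namespace Summit.AnomalousDissipation.AnomalousDissipation.Theorems.CubicParityLoud.Negative

open MeasureTheory Filter UnitAddTorus
open scoped InnerProductSpace RealInnerProductSpace ENNReal
open Literature.Analysis.FunctionSpaces Literature.Analysis.FluidPDE
open Summit.AnomalousDissipation.AnomalousDissipation.Theses.MomentParity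

/-! ## §8 THE MEAN FLOW: `ū_N = Σ_a (∫(u,e_a)dμ) e_a` does the work, and `‖ū_N‖₂ ≥ ε/‖f‖₂`

For a law carried by level-`N` fields the level-`N` mean flow `ū_N` (frame synthesis of the mean frame
coefficients — a smooth solenoidal mean-zero band-limited field, i.e. itself an admissible test) satisfies
`(ū_N, g) = ∫ (u, g) dμ` for every `L²` field `g` band-limited to the ball; with the energy row,
`ensembleDissipation = (ū_N, P_N f) ≤ ‖ū_N‖₂ ‖f‖₂`: **every witness carries a macroscopic mean flow,
`‖ū_N‖₂ ≥ ε/‖f‖₂`** (no zero-mean-flow / isotropic witness at any level, whatever the fluctuations do). -/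

section MeanFlow

/-- The mean frame coefficients `c_i(μ) = ∫ (u, e_i) dμ` of a law on `H` (Galerkin frame of level `N`). -/
def meanCoeff (N : ℕ) (μ : Measure H3) (i : Fin (Torus.galerkinTest (d := Fin 3) N one_pos).m) : ℝ :=
  ∫ u, Torus.pairing u.1 (frameG N i) ∂μ

/-- The level-`N` MEAN FLOW `ū_N(x) = Σ_i c_i(μ) e_i(x)`. -/
def meanFlow (N : ℕ) (μ : Measure H3) : T3 → R3 := fun x => ∑ i, meanCoeff N μ i • frameG N i x

/-- Frame fields are integrable. -/
theorem integrable_frameG (N : ℕ) (i : Fin (Torus.galerkinTest (d := Fin 3) N one_pos).m) :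
    Integrable (frameG N i) volume :=
  ((isBandTest_frameG N i).1.memLp 2).integrable one_le_two

/-- The mean flow is an admissible level-`N` band test (smooth, solenoidal, mean-zero, band-limited). -/
theorem isBandTest_meanFlow (N : ℕ) (μ : Measure H3) : IsBandTest N (meanFlow N μ) := by
  refine ⟨Torus.IsSmooth.sum_smul Finset.univ (meanCoeff N μ) fun i => (isBandTest_frameG N i).1,
    Torus.IsDivFree.sum_smul Finset.univ (meanCoeff N μ) (fun i => (isBandTest_frameG N i).1)
      fun i => (isBandTest_frameG N i).2.1,
    Torus.HasZeroMean.sum_smul Finset.univ (meanCoeff N μ) (integrable_frameG N)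
      fun i => (isBandTest_frameG N i).2.2.1, fun k hk => ?_⟩
  have hfun : (EuclideanSpace.complexify ∘ meanFlow N μ) =
      fun x => ∑ i ∈ Finset.univ, (((meanCoeff N μ i : ℝ) : ℂ) • (EuclideanSpace.complexify ∘ frameG N i)) x := by
    funext x
    simp only [Function.comp_apply, meanFlow, map_sum, Pi.smul_apply]
    refine Finset.sum_congr rfl fun i _ => ?_
    rw [LinearIsometry.map_smul, Complex.coe_smul]
  rw [hfun, Torus.mFourierCoeff_finset_sum _ (fun i _ =>
    (Torus.integrable_complexify_comp (integrable_frameG N i)).smul _)]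
  refine Finset.sum_eq_zero fun i _ => ?_
  rw [Torus.mFourierCoeff_const_smul, (isBandTest_frameG N i).2.2.2 k hk, smul_zero]

/-- Pairing a finite frame combination with an `L²` field: `(Σ_i c_i e_i, g) = Σ_i c_i (e_i, g)`. -/
theorem integral_inner_sum_smul_frameG (N : ℕ) (c : Fin (Torus.galerkinTest (d := Fin 3) N one_pos).m → ℝ)
    {g : T3 → R3} (hg : MemLp g 2 volume) :
    ∫ x, ⟪∑ i, c i • frameG N i x, g x⟫_ℝ = ∑ i, c i * ∫ x, ⟪frameG N i x, g x⟫_ℝ := by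
  have hint : ∀ i, Integrable (fun x => ⟪frameG N i x, g x⟫_ℝ) volume := by
    intro i
    obtain ⟨C, hC⟩ : ∃ C, ∀ x, ‖frameG N i x‖ ≤ C :=
      ⟨_, fun x => Torus.norm_realTrigPoly_apply_le _ _ x⟩
    refine Integrable.mono' ((hg.integrable one_le_two).norm.const_mul C)
      ((isBandTest_frameG N i).1.continuous.aestronglyMeasurable.inner hg.aestronglyMeasurable)
      (ae_of_all _ fun x => ?_)
    rw [Real.norm_eq_abs]
    calc |⟪frameG N i x, g x⟫_ℝ| ≤ ‖frameG N i x‖ * ‖g x‖ := abs_real_inner_le_norm _ _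
      _ ≤ C * ‖g x‖ := mul_le_mul_of_nonneg_right (hC x) (norm_nonneg _)
  simp_rw [sum_inner, real_inner_smul_left]
  rw [integral_finsetSum _ fun i _ => (hint i).const_mul (c i)]
  exact Finset.sum_congr rfl fun i _ => integral_const_mul _ _

/-- Frame synthesis of the pairings is the truncation: `Σ_i (u, e_i) e_i = P_N u` (pointwise). -/
theorem sum_pairing_smul_frameG (N : ℕ) (u : H3) (x : T3) :
    ∑ i, Torus.pairing u.1 (frameG N i) • frameG N i x = Torus.fourierTruncate N ((u : L2T3) : T3 → R3) x := by
  have h := Torus.sum_galerkinTest_eq (d := Fin 3) N one_pos (fun e => Torus.pairing u.1 e • e x)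
  exact h.trans (Torus.sum_integral_inner_frameField_smul u.2 N x)

/-- **The pairing of `u ∈ H` with a band-limited `L²` field runs through the frame**:
`(u, g) = Σ_i (u, e_i)(e_i, g)`. -/
theorem pairing_eq_sum_frameG (N : ℕ) (u : H3) {g : T3 → R3} (hg : MemLp g 2 volume)
    (hband : ∀ k ∉ Torus.freqBall N, mFourierCoeff (EuclideanSpace.complexify ∘ g) k = 0) :
    Torus.pairing u.1 g = ∑ i, Torus.pairing u.1 (frameG N i) * ∫ x, ⟪frameG N i x, g x⟫_ℝ := by
  have hmem : MemLp ((u : L2T3) : T3 → R3) 2 volume := Lp.memLp _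
  calc Torus.pairing u.1 g = ∫ x, ⟪((u : L2T3) : T3 → R3) x, g x⟫_ℝ := rfl
    _ = ∫ x, ⟪Torus.fourierTruncate N ((u : L2T3) : T3 → R3) x, g x⟫_ℝ :=
        (Torus.integral_inner_fourierTruncate_eq hmem hg hband).symm
    _ = ∫ x, ⟪∑ i, Torus.pairing u.1 (frameG N i) • frameG N i x, g x⟫_ℝ :=
        integral_congr_ae (ae_of_all _ fun x => by simp only [sum_pairing_smul_frameG])
    _ = ∑ i, Torus.pairing u.1 (frameG N i) * ∫ x, ⟪frameG N i x, g x⟫_ℝ :=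
        integral_inner_sum_smul_frameG N _ hg

/-- **THE MEAN FLOW DOES THE WORK**: `(ū_N, g) = ∫ (u, g) dμ` for every `L²` field `g` band-limited to
the ball of radius `N` (finite law, `‖u‖` integrable). -/
theorem integral_inner_meanFlow {N : ℕ} {μ : Measure H3} [IsFiniteMeasure μ]
    (h1 : Integrable (fun u : H3 => ‖u‖) μ) {g : T3 → R3} (hg : MemLp g 2 volume)
    (hband : ∀ k ∉ Torus.freqBall N, mFourierCoeff (EuclideanSpace.complexify ∘ g) k = 0) :
    ∫ x, ⟪meanFlow N μ x, g x⟫_ℝ = ∫ u, Torus.pairing u.1 g ∂μ := by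
  simp_rw [pairing_eq_sum_frameG N _ hg hband]
  rw [integral_finsetSum _ fun i _ =>
    (integrable_pairing ((isBandTest_frameG N i).1.memLp 2) h1).mul_const _]
  simp_rw [integral_mul_const]
  exact integral_inner_sum_smul_frameG N (meanCoeff N μ) hg

/-- Cauchy–Schwarz for two `L²` fields on the torus. -/
theorem integral_inner_le_sqrt_mul_sqrt {a b : T3 → R3} (ha : MemLp a 2 volume) (hb : MemLp b 2 volume) :
    ∫ x, ⟪a x, b x⟫_ℝ ≤ Real.sqrt (∫ x, ‖a x‖ ^ 2) * Real.sqrt (∫ x, ‖b x‖ ^ 2) := by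
  have h : ∫ x, ⟪a x, b x⟫_ℝ = ⟪ha.toLp a, hb.toLp b⟫_ℝ := by
    rw [MeasureTheory.L2.inner_def]
    refine integral_congr_ae ?_
    filter_upwards [ha.coeFn_toLp, hb.coeFn_toLp] with x hxa hxb
    rw [hxa, hxb]
  rw [h, ← norm_toLp_eq_sqrt ha, ← norm_toLp_eq_sqrt hb]
  exact real_inner_le_norm _ _

/-- **MEAN-FLOW FLOOR**: every witness has `ε ≤ ‖f‖₂ · ‖ū_N‖₂` — a macroscopic level-`N` mean flow. -/
theorem IsWitness.le_meanFlow {f : T3 → R3} (hf : MemLp f 2 volume) {ν : ℝ} {N : ℕ} {E ε : ℝ}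
    {μ : Measure H3} (hW : IsWitness f ν N E ε μ) :
    ε ≤ Real.sqrt (∫ x, ‖f x‖ ^ 2) * Real.sqrt (∫ x, ‖meanFlow N μ x‖ ^ 2) := by
  have hP := hW.1
  have hlev := hW.2.1
  have h1 : Integrable (fun u : H3 => ‖u‖) μ := by
    simpa using integrable_norm_pow_of_cube hW.2.2.1 (p := 1) (by norm_num)
  have hfint : Integrable f volume := hf.integrable one_le_two
  have hPf : MemLp (Torus.fourierTruncate N f) 2 volume := Torus.memLp_fourierTruncate N f 2
  have hPf_band : ∀ k ∉ Torus.freqBall N,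
      mFourierCoeff (EuclideanSpace.complexify ∘ Torus.fourierTruncate N f) k = 0 := by
    intro k hk
    rw [Torus.mFourierCoeff_fourierTruncate hfint, if_neg hk]
  -- on level-N fields, `(u, f) = (u, P_N f)`
  have hswap : ∀ᵐ u ∂μ, Torus.pairing u.1 f = Torus.pairing u.1 (Torus.fourierTruncate N f) := by
    filter_upwards [hlev] with u hu
    have hmem : MemLp ((u : L2T3) : T3 → R3) 2 volume := Lp.memLp _
    have hub : ∀ k ∉ Torus.freqBall N, mFourierCoeff (EuclideanSpace.complexify ∘ ((u : L2T3) : T3 → R3)) k = 0 :=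
      fun k hk => hu k (fun h => hk (Finset.mem_of_mem_erase h))
    have h := Torus.integral_inner_fourierTruncate_eq hf hmem hub
    have e1 : Torus.pairing u.1 f = ∫ x, ⟪f x, ((u : L2T3) : T3 → R3) x⟫_ℝ :=
      integral_congr_ae (ae_of_all _ fun x => real_inner_comm _ _)
    have e2 : Torus.pairing u.1 (Torus.fourierTruncate N f) =
        ∫ x, ⟪Torus.fourierTruncate N f x, ((u : L2T3) : T3 → R3) x⟫_ℝ :=
      integral_congr_ae (ae_of_all _ fun x => real_inner_comm _ _)
    rw [e1, e2]
    exact h.symm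
  have hmf : MemLp (meanFlow N μ) 2 volume := (isBandTest_meanFlow N μ).1.memLp 2
  calc ε ≤ ∫ u, Torus.pairing u.1 f ∂μ := hW.integral_pairing_ge hf
    _ = ∫ u, Torus.pairing u.1 (Torus.fourierTruncate N f) ∂μ := integral_congr_ae hswap
    _ = ∫ x, ⟪meanFlow N μ x, Torus.fourierTruncate N f x⟫_ℝ := (integral_inner_meanFlow h1 hPf hPf_band).symm
    _ ≤ Real.sqrt (∫ x, ‖meanFlow N μ x‖ ^ 2) * Real.sqrt (∫ x, ‖Torus.fourierTruncate N f x‖ ^ 2) :=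
        integral_inner_le_sqrt_mul_sqrt hmf hPf
    _ ≤ Real.sqrt (∫ x, ‖meanFlow N μ x‖ ^ 2) * Real.sqrt (∫ x, ‖f x‖ ^ 2) :=
        mul_le_mul_of_nonneg_left (Real.sqrt_le_sqrt (Torus.integral_norm_sq_fourierTruncate_le hf N))
          (Real.sqrt_nonneg _)
    _ = Real.sqrt (∫ x, ‖f x‖ ^ 2) * Real.sqrt (∫ x, ‖meanFlow N μ x‖ ^ 2) := mul_comm _ _

end MeanFlow


/-! ## §9 LAMINAR CEILING `ε ≤ ‖f‖₂²/(4π²ν)`: the threshold `ν₀` is load-bearing (`ν₀ ≲ ‖f‖₂²/ε`)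

Chain: `ε ≤ D := ensembleDissipation = (ū_N, P_N f) ≤ ‖ū_N‖₂ ‖f‖₂` (§8) and
`‖ū_N‖₂² = ∫ (u, ū_N) dμ ≤ ‖ū_N‖₂ ∫‖u‖dμ`, `(∫‖u‖)² ≤ ∫‖u‖² ≤ (4π²)⁻¹ ∫‖∇u‖² = D/(4π²ν)` (Poincaré on
`H`), whence `D ≤ ‖f‖₂ (D/(4π²ν))^{1/2}`, i.e. the classical laminar bound `D ≤ ‖f‖₂²/(4π²ν)`. So witnesses
exist only for `ν ≤ ‖f‖₂²/(4π²ε)`, and the strengthening of the crux without the viscosity threshold is FALSE. -/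

section Laminar

/-- The mean flow is controlled by the mean speed: `‖ū_N‖₂ ≤ ∫ ‖u‖ dμ`. -/
theorem norm_meanFlow_le {N : ℕ} {μ : Measure H3} [IsFiniteMeasure μ] (h1 : Integrable (fun u : H3 => ‖u‖) μ) :
    Real.sqrt (∫ x, ‖meanFlow N μ x‖ ^ 2) ≤ ∫ u, ‖u‖ ∂μ := by
  have hmf : MemLp (meanFlow N μ) 2 volume := (isBandTest_meanFlow N μ).1.memLp 2
  have hband : ∀ k ∉ Torus.freqBall N, mFourierCoeff (EuclideanSpace.complexify ∘ meanFlow N μ) k = 0 :=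
    fun k hk => (isBandTest_meanFlow N μ).2.2.2 k (fun h => hk (Finset.mem_of_mem_erase h))
  set M : ℝ := Real.sqrt (∫ x, ‖meanFlow N μ x‖ ^ 2) with hM
  have hM0 : 0 ≤ M := Real.sqrt_nonneg _
  -- `M² = (ū, ū) = ∫ (u, ū) dμ ≤ M ∫ ‖u‖ dμ`
  have hsq : M ^ 2 = ∫ x, ⟪meanFlow N μ x, meanFlow N μ x⟫_ℝ := by
    rw [hM, Real.sq_sqrt (integral_nonneg fun _ => by positivity)]
    refine integral_congr_ae (ae_of_all _ fun x => ?_)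
    simp only [real_inner_self_eq_norm_sq]
  have hle : M ^ 2 ≤ M * ∫ u, ‖u‖ ∂μ := by
    rw [hsq, integral_inner_meanFlow h1 hmf hband]
    calc ∫ u, Torus.pairing u.1 (meanFlow N μ) ∂μ ≤ ∫ u, ‖u‖ * ‖hmf.toLp (meanFlow N μ)‖ ∂μ :=
          integral_mono (integrable_pairing hmf h1) (h1.mul_const _) fun u =>
            (le_abs_self _).trans (Torus.abs_pairing_coe_le hmf u)
      _ = M * ∫ u, ‖u‖ ∂μ := by rw [integral_mul_const, norm_toLp_eq_sqrt, mul_comm]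
  by_cases hMz : M = 0
  · rw [hMz]; exact integral_nonneg fun _ => norm_nonneg _
  · have hMpos : 0 < M := lt_of_le_of_ne hM0 (Ne.symm hMz)
    nlinarith

/-- **POINCARÉ IN THE MEAN**: `4π² · ensembleEnergy μ ≤ ensembleDissipation ν μ / ν` for a law with finite
mean enstrophy and integrable energy (`ν > 0`). -/
theorem ensembleEnergy_le_dissipation {μ : Measure H3} (hfin : Torus.ensembleEnstrophy μ ≠ ⊤)
    (h2 : Integrable (fun u : H3 => ‖u‖ ^ 2) μ) {ν : ℝ} (hν : 0 < ν) :
    4 * Real.pi ^ 2 * Torus.ensembleEnergy μ ≤ Torus.ensembleDissipation ν μ / ν := by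
  have hpt : ∀ u : H3, ENNReal.ofReal (4 * Real.pi ^ 2 * ‖u‖ ^ 2) ≤ Torus.eGradNormSq ((u : L2T3) : T3 → R3) := by
    intro u
    have h := Torus.ofReal_integral_norm_sq_le_eGradNormSq u.2
    rwa [Torus.integral_norm_sq_coe_eq, ← ENNReal.ofReal_mul (by positivity)] at h
  have hlin : ∫⁻ u, ENNReal.ofReal (4 * Real.pi ^ 2 * ‖u‖ ^ 2) ∂μ ≤ Torus.ensembleEnstrophy μ :=
    lintegral_mono hpt
  have hofReal : ∫⁻ u, ENNReal.ofReal (4 * Real.pi ^ 2 * ‖u‖ ^ 2) ∂μ =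
      ENNReal.ofReal (4 * Real.pi ^ 2 * Torus.ensembleEnergy μ) := by
    rw [Torus.ensembleEnergy, ← integral_const_mul]
    exact (ofReal_integral_eq_lintegral_ofReal (h2.const_mul _) (ae_of_all _ fun u => by positivity)).symm
  have hE0 : 0 ≤ 4 * Real.pi ^ 2 * Torus.ensembleEnergy μ :=
    mul_nonneg (by positivity) (integral_nonneg fun _ => by positivity)
  have h := ENNReal.toReal_mono hfin (hofReal ▸ hlin)
  rw [ENNReal.toReal_ofReal hE0] at h
  rw [Torus.ensembleDissipation, mul_div_assoc, mul_div_assoc', mul_div_cancel_left₀ _ hν.ne']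
  exact h

/-- **LAMINAR CEILING FOR WITNESSES**: `ε ≤ ‖f‖₂² / (4π²ν)`. Hence witnesses of the crux exist only for
`ν ≤ ‖f‖₂²/(4π²ε)`: the viscosity threshold `ν₀` is load-bearing. -/
theorem IsWitness.laminar {f : T3 → R3} (hf : MemLp f 2 volume) {ν : ℝ} (hν : 0 < ν) {N : ℕ} {E ε : ℝ}
    (hε : 0 < ε) {μ : Measure H3} (hW : IsWitness f ν N E ε μ) :
    ε ≤ (∫ x, ‖f x‖ ^ 2) / (4 * Real.pi ^ 2 * ν) := by
  have hP := hW.1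
  have h1 : Integrable (fun u : H3 => ‖u‖) μ := by
    simpa using integrable_norm_pow_of_cube hW.2.2.1 (p := 1) (by norm_num)
  have h2 : Integrable (fun u : H3 => ‖u‖ ^ 2) μ := integrable_norm_pow_of_cube hW.2.2.1 (p := 2) (by norm_num)
  set D : ℝ := Torus.ensembleDissipation ν μ with hD
  set A : ℝ := Real.sqrt (∫ x, ‖f x‖ ^ 2) with hA
  have hA0 : 0 ≤ A := Real.sqrt_nonneg _
  have hεD : ε ≤ D := hW.2.2.2.2.2
  -- `D ≤ A ‖ū‖ ≤ A ∫‖u‖ ≤ A √energy ≤ A √(D/(4π²ν))`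
  have hstep1 : D ≤ A * Real.sqrt (∫ x, ‖meanFlow N μ x‖ ^ 2) := by
    rw [hD, hW.dissipation_eq hf]
    have := hW.le_meanFlow hf
    -- re-run the §8 chain with `∫(u,f)` in place of `ε`
    have hlev := hW.2.1
    have hfint : Integrable f volume := hf.integrable one_le_two
    have hPf : MemLp (Torus.fourierTruncate N f) 2 volume := Torus.memLp_fourierTruncate N f 2
    have hPf_band : ∀ k ∉ Torus.freqBall N,
        mFourierCoeff (EuclideanSpace.complexify ∘ Torus.fourierTruncate N f) k = 0 := by
      intro k hk; rw [Torus.mFourierCoeff_fourierTruncate hfint, if_neg hk]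
    have hswap : ∀ᵐ u ∂μ, Torus.pairing u.1 f = Torus.pairing u.1 (Torus.fourierTruncate N f) := by
      filter_upwards [hlev] with u hu
      have hmem : MemLp ((u : L2T3) : T3 → R3) 2 volume := Lp.memLp _
      have hub : ∀ k ∉ Torus.freqBall N, mFourierCoeff (EuclideanSpace.complexify ∘ ((u : L2T3) : T3 → R3)) k = 0 :=
        fun k hk => hu k (fun h => hk (Finset.mem_of_mem_erase h))
      have h := Torus.integral_inner_fourierTruncate_eq hf hmem hub
      have e1 : Torus.pairing u.1 f = ∫ x, ⟪f x, ((u : L2T3) : T3 → R3) x⟫_ℝ :=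
        integral_congr_ae (ae_of_all _ fun x => real_inner_comm _ _)
      have e2 : Torus.pairing u.1 (Torus.fourierTruncate N f) =
          ∫ x, ⟪Torus.fourierTruncate N f x, ((u : L2T3) : T3 → R3) x⟫_ℝ :=
        integral_congr_ae (ae_of_all _ fun x => real_inner_comm _ _)
      rw [e1, e2]; exact h.symm
    have hmf : MemLp (meanFlow N μ) 2 volume := (isBandTest_meanFlow N μ).1.memLp 2
    calc ∫ u, Torus.pairing u.1 f ∂μ = ∫ u, Torus.pairing u.1 (Torus.fourierTruncate N f) ∂μ :=
          integral_congr_ae hswap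
      _ = ∫ x, ⟪meanFlow N μ x, Torus.fourierTruncate N f x⟫_ℝ := (integral_inner_meanFlow h1 hPf hPf_band).symm
      _ ≤ Real.sqrt (∫ x, ‖meanFlow N μ x‖ ^ 2) * Real.sqrt (∫ x, ‖Torus.fourierTruncate N f x‖ ^ 2) :=
          integral_inner_le_sqrt_mul_sqrt hmf hPf
      _ ≤ Real.sqrt (∫ x, ‖meanFlow N μ x‖ ^ 2) * A :=
          mul_le_mul_of_nonneg_left (Real.sqrt_le_sqrt (Torus.integral_norm_sq_fourierTruncate_le hf N))
            (Real.sqrt_nonneg _)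
      _ = A * Real.sqrt (∫ x, ‖meanFlow N μ x‖ ^ 2) := mul_comm _ _
  have hstep2 : Real.sqrt (∫ x, ‖meanFlow N μ x‖ ^ 2) ≤ Real.sqrt (Torus.ensembleEnergy μ) :=
    (norm_meanFlow_le h1).trans ((le_abs_self _).trans (Real.abs_le_sqrt (sq_integral_norm_le h2)))
  have hfin : Torus.ensembleEnstrophy μ ≠ ⊤ := hW.ensembleEnstrophy_ne_top hε
  have hstep3 : 4 * Real.pi ^ 2 * Torus.ensembleEnergy μ ≤ D / ν := ensembleEnergy_le_dissipation hfin h2 hν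
  have hc : 0 < 4 * Real.pi ^ 2 * ν := by positivity
  have hD0 : 0 ≤ D := hε.le.trans hεD
  -- square the chain: `D² ≤ A² · energy ≤ A² D/(4π²ν)`
  have hchain : D ≤ A * Real.sqrt (Torus.ensembleEnergy μ) :=
    hstep1.trans (mul_le_mul_of_nonneg_left hstep2 hA0)
  have hEn : 0 ≤ Torus.ensembleEnergy μ := integral_nonneg fun _ => by positivity
  have hsq : D ^ 2 ≤ A ^ 2 * Torus.ensembleEnergy μ := by
    calc D ^ 2 ≤ (A * Real.sqrt (Torus.ensembleEnergy μ)) ^ 2 := pow_le_pow_left₀ hD0 hchain 2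
      _ = A ^ 2 * Torus.ensembleEnergy μ := by rw [mul_pow, Real.sq_sqrt hEn]
  have hsq2 : D ^ 2 ≤ A ^ 2 * (D / (4 * Real.pi ^ 2 * ν)) := by
    have : Torus.ensembleEnergy μ ≤ D / (4 * Real.pi ^ 2 * ν) := by
      rw [le_div_iff₀ hc]
      calc Torus.ensembleEnergy μ * (4 * Real.pi ^ 2 * ν) = (4 * Real.pi ^ 2 * Torus.ensembleEnergy μ) * ν := by ring
        _ ≤ (D / ν) * ν := mul_le_mul_of_nonneg_right hstep3 hν.le
        _ = D := div_mul_cancel₀ _ hν.ne'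
    exact hsq.trans (mul_le_mul_of_nonneg_left this (sq_nonneg _))
  have hA2 : A ^ 2 = ∫ x, ‖f x‖ ^ 2 := Real.sq_sqrt (integral_nonneg fun _ => by positivity)
  -- conclude `D ≤ A²/(4π²ν)`
  have hDle : D ≤ A ^ 2 / (4 * Real.pi ^ 2 * ν) := by
    by_cases hDz : D = 0
    · rw [hDz]; positivity
    · have hDpos : 0 < D := lt_of_le_of_ne hD0 (Ne.symm hDz)
      rw [le_div_iff₀ hc]
      have h' : D ^ 2 * (4 * Real.pi ^ 2 * ν) ≤ A ^ 2 * D := by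
        have hx : A ^ 2 * (D / (4 * Real.pi ^ 2 * ν)) * (4 * Real.pi ^ 2 * ν) = A ^ 2 * D := by
          field_simp
        calc D ^ 2 * (4 * Real.pi ^ 2 * ν) ≤ A ^ 2 * (D / (4 * Real.pi ^ 2 * ν)) * (4 * Real.pi ^ 2 * ν) :=
              mul_le_mul_of_nonneg_right hsq2 hc.le
          _ = A ^ 2 * D := hx
      nlinarith
  rw [← hA2]
  exact hεD.trans hDle

/-- STRENGTHENING (refuted): the crux WITHOUT the viscosity threshold `ν < ν₀` (all `ν > 0`). -/
def CubicParityLoudAllViscosities : Prop :=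
  ∀ f : T3 → R3, Torus.IsSmooth f → Torus.IsDivFree f → Torus.HasZeroMean f → f ≠ 0 →
    ∃ E ε : ℝ, 0 < ε ∧ ∀ ν : ℝ, 0 < ν → ∃ N₀ : ℕ, ∀ N : ℕ, N₀ ≤ N → ∃ μ : Measure H3, IsWitness f ν N E ε μ

/-- `ν₀` is load-bearing: at `ν = (‖f‖₂² + 1)/(2π²ε)` the laminar ceiling leaves `< ε`. -/
theorem not_cubicParityLoudAllViscosities : ¬ CubicParityLoudAllViscosities := by
  intro h
  obtain ⟨E, ε, hε, h⟩ := h shearForce isSmooth_shearForce isDivFree_shearForce hasZeroMean_shearForce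
    shearForce_ne_zero
  set A2 : ℝ := ∫ x, ‖shearForce x‖ ^ 2 with hA2
  have hA0 : 0 ≤ A2 := integral_nonneg fun _ => by positivity
  set ν : ℝ := (A2 + 1) / (2 * Real.pi ^ 2 * ε) with hν
  have hνpos : 0 < ν := by positivity
  obtain ⟨N₀, hN⟩ := h ν hνpos
  obtain ⟨μ, hW⟩ := hN N₀ le_rfl
  have hlam := hW.laminar (memLp_of_isSmooth isSmooth_shearForce) hνpos hε
  rw [← hA2] at hlam
  have hden : 0 < 4 * Real.pi ^ 2 * ν := by positivity
  have key : A2 / (4 * Real.pi ^ 2 * ν) < ε := by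
    rw [div_lt_iff₀ hden, hν]
    have : ε * (4 * Real.pi ^ 2 * ((A2 + 1) / (2 * Real.pi ^ 2 * ε))) = 2 * (A2 + 1) := by
      field_simp; ring
    rw [this]; linarith
  linarith

end Laminar

end Summit.AnomalousDissipation.AnomalousDissipation.Theorems.CubicParityLoud.Negative
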